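import Summits.CriticalPhenomena.CardyFormulaZ2.Theorems.CardyComplexConeEdgePrecompactUFRSArmDominationStrands
import Summits.CriticalPhenomena.CardyFormulaZ2.Theorems.CardyComplexConeEdgePrecompactUFRSArmDominationExit
import Summits.CriticalPhenomena.CardyFormulaZ2.Theorems.CardyComplexConeEdgePrecompactUFRSArmDominationResiduals

/-!
# Arm domination, SPLIT case with a free tail: three strands at the last departure
(line `qkz-strip-boundary-arm` of crux `CardyComplexCone.EdgePrecompact`, stmt-CriticalPhenomena-11387;
deterministic assembly of the corrected item (H₁) `ufrs_armDomination2` of the road map for the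
uniform forward response stability "UFRS", SPLIT branch of `ufrs_failureStructure`, case
`j < T` of `ufrs_lastDeparture`)

Setting of `ufrs_lastDeparture` (`…UFRSLastDeparture.lean`): the simple first stretch
`S₀ = O₀ a [0, n]`, the split corner `e = O₀ a m` in the collar, the run `O₁ e [0, T]` of the
second dynamics, and the LAST CONTACT `ζ = O₀ a i = O₁ e j` of the run with `S₀`. When `j < T`
the free tail `F = O₁ e (j, T]` is nonempty, `ζ` sits at a collar discrepancy edge, and the three
stretches `W = O₀ a [0, i)`, `P = O₀ a (i, n]`, `F` are pairwise corner-disjoint. `P` always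
reaches the ball, i.e. distance `≥ ρ/4` from the collar point `z = E.δ ζ.1`; `W` reaches `a`
(far, unless `a` is the start corner at the marked point `e_a` near `z`); `F` reaches the ball
or THE exit corner of the translate (`runEnd_exitType_W3H`), i.e. the marked edge `e_b + w`. The
theorem `ufrs_freeTailCase_cert_of` turns this into the certificate `ufrsCert E w z (4η) (ρ/2)`
of `…UFRSEvents.lean` (FAR when the three strands are long; NEAR/MARKED when exactly one of
the two marked edges is within `ρ/4` of `z`, `mem_ufrsCert_of_two_far_and_marked_W3H`), EXCEPT in
the doubly marked configuration — start pair, both `a` and the exit corner of the translate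
within `ρ/4` of `ζ` — which is the registered residual sub-goal `ufrs_doublyMarkedCase_cert`,
taken as a hypothesis (there the only long named strand at `z` is `P`; a second one requires a
planar-duality argument producing an interface of the translate's dynamics next to `P`).

References: S. Smirnov, C. R. Acad. Sci. Paris 333 (2001), §2; P. Nolin, Electron. J. Probab. 13
(2008), §4.
-/

namespace Summit.CriticalPhenomena.CardyFormulaZ2.Cruxes.EdgePrecompact.QkzStripBoundaryArm

open MeasureTheory Filter Set Metric
open scoped Topology BigOperators Pointwise
open Literature.Probability.LatticeModels Literature.Probability.Percolation
open Literature.Probability.RandomPlanarGeometry (DobrushinDomain)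
open Summit.CriticalPhenomena.CardyFormulaZ2.Theses.CardyComplexCone

noncomputable section

/-- **The free tail of the second run certifies, up to the doubly marked configuration**
(registered conditional sub-goal `ufrs_freeTailCase_cert_of` of stmt-CriticalPhenomena-11387;
the main case of the SPLIT branch of the corrected arm domination `ufrs_armDomination2`).
HYPOTHESIS: `ufrsResidualDoublyMarked`, the registered residual sub-goal `ufrs_doublyMarkedCase_cert` (the same data, for
the START pair, when the free tail ends at the exit corner of the translate and both that exit
corner and the start corner `a` are within `ρ/4` of the last contact). DATA: the SPLIT branch of
`ufrs_failureStructure` (fine admissible datum of `D`, shift `‖E.δ w‖ < η`, `2ρ`-deep ball of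
radius `ρ ≥ 4η`, admissible pair, good first stretch re-entering the ball at `n`, synchronised
collar index `m < n` with a SPLIT discrepancy, the mismatch clause, a run end `T` of the second
dynamics from `e = O₀ a m`) and a last contact `O₁ e j = O₀ a i` with `j < T` (nonempty free
tail `O₁ e (j, T]`, cf. `ufrs_lastDeparture`). CONCLUSION: `ω` is certified at a collar point:
at `z = E.δ (O₀ a i).1` the three pairwise corner-disjoint strands `O₀ a [0, i)` (to `a`),
`O₀ a (i, n]` (to the ball) and `O₁ e (j, T]` (to the ball, or to the exit corner of the
translate) give the FAR branch when all three are long, and the NEAR/MARKED branches when one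
of them ends at a marked edge within `ρ/4` of `z` (`mem_ufrsCert_of_two_far_and_marked_W3H`); the
remaining configuration is the hypothesis. -/
theorem ufrs_freeTailCase_cert_of : ufrsResidualDoublyMarked → ∀ (D : DobrushinDomain) (η : ℝ), 0 < η → ∃ δ₀ > (0:ℝ), ∀ E : DiscreteDobrushin, E.Ω = D.carrier → E.IsZdAdmissible → E.δ < δ₀ → ∀ (v w : Site 2) (ρ : ℝ), 4 * η ≤ ρ → 2 * ρ ≤ infDist (meshPoint E.δ v) D.carrierᶜ → ‖meshPoint E.δ w‖ < η → ∀ (ω : BondConfig (Site 2)) (a a' : Site 2 × Fin 4) (n m k T j i : ℕ), ((E.IsStartCorner a ∧ (shiftData E w).IsStartCorner a') ∨ (a = a' ∧ medialPoint E.δ (cSrc a) ∈ ball (meshPoint E.δ v) ρ ∧ medialPoint E.δ (cTgt a) ∉ ball (meshPoint E.δ v) ρ)) → (∀ i < n, medialPoint E.δ (cTgt (cornerOrbit (E.bcBondConfig ω) a i)) ∉ ball (meshPoint E.δ v) ρ ∧ E.IsInnerFace (cFace (cornerOrbit (E.bcBondConfig ω) a (i + 1)))) → medialPoint E.δ (cTgt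 (cornerOrbit (E.bcBondConfig ω) a n)) ∈ ball (meshPoint E.δ v) ρ → m < n → (∀ i < k, medialPoint E.δ (cTgt (cornerOrbit ((shiftData E w).bcBondConfig ω) a' i)) ∉ ball (meshPoint E.δ v) ρ ∧ (shiftData E w).IsInnerFace (cFace (cornerOrbit ((shiftData E w).bcBondConfig ω) a' (i + 1)))) → cornerOrbit ((shiftData E w).bcBondConfig ω) a' k = cornerOrbit (E.bcBondConfig ω) a m → ∑ i ∈ Finset.range k, turnOf ((shiftData E w).bcBondConfig ω) (cornerOrbit ((shiftData E w).bcBondConfig ω) a' i) = ∑ i ∈ Finset.range m, turnOf (E.bcBondConfig ω) (cornerOrbit (E.bcBondConfig ω) a i) → infDist (meshPoint E.δ (cornerOrbit (E.bcBondConfig ω) a m).1) D.carrierᶜ < 3 * η → ¬ (cTgt (cornerOrbit (E.bcBondConfig ω) a m) ∈ E.bcBondConfig ω ↔ cTgt (cornerOrbit (E.bcBondConfig ω) a m) ∈ (shiftData E w).bcBondConfig ω) → (∀ j j₀ : ℕ, m < j₀ → j₀ ≤ n → (∀ i < j, medialPoint E.δ (cTgt (cornerOrbit ((shiftData E w).bcBondConfig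 ω) (cornerOrbit (E.bcBondConfig ω) a m) i)) ∉ ball (meshPoint E.δ v) ρ ∧ (shiftData E w).IsInnerFace (cFace (cornerOrbit ((shiftData E w).bcBondConfig ω) (cornerOrbit (E.bcBondConfig ω) a m) (i + 1)))) → cornerOrbit ((shiftData E w).bcBondConfig ω) (cornerOrbit (E.bcBondConfig ω) a m) j = cornerOrbit (E.bcBondConfig ω) a j₀ → ∑ i ∈ Finset.range j, turnOf ((shiftData E w).bcBondConfig ω) (cornerOrbit ((shiftData E w).bcBondConfig ω) (cornerOrbit (E.bcBondConfig ω) a m) i) ≠ ∑ i ∈ Finset.Ico m j₀, turnOf (E.bcBondConfig ω) (cornerOrbit (E.bcBondConfig ω) a i)) → (∀ i < T, medialPoint E.δ (cTgt (cornerOrbit ((shiftData E w).bcBondConfig ω) (cornerOrbit (E.bcBondConfig ω) a m) i)) ∉ ball (meshPoint E.δ v) ρ ∧ (shiftData E w).IsInnerFace (cFace (cornerOrbit ((shiftData E w).bcBondConfig ω) (cornerOrbit (E.bcBondConfig ω) a m) (i + 1)))) → (medialPoint E.δ (cTgt (cornerOrbit ((shiftData E w).bcBondConfig ω) (cornerOrbit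 (E.bcBondConfig ω) a m) T)) ∈ ball (meshPoint E.δ v) ρ ∨ ¬ (shiftData E w).IsInnerFace (cFace (cornerOrbit ((shiftData E w).bcBondConfig ω) (cornerOrbit (E.bcBondConfig ω) a m) (T + 1)))) → j < T → i ≤ n → cornerOrbit ((shiftData E w).bcBondConfig ω) (cornerOrbit (E.bcBondConfig ω) a m) j = cornerOrbit (E.bcBondConfig ω) a i → (∀ j', j < j' → j' ≤ T → ∀ i' ≤ n, cornerOrbit ((shiftData E w).bcBondConfig ω) (cornerOrbit (E.bcBondConfig ω) a m) j' ≠ cornerOrbit (E.bcBondConfig ω) a i') → ∃ z ∈ D.carrier, infDist z D.carrierᶜ < 3 * η ∧ ω ∈ ufrsCert E w z (4 * η) (ρ / 2) := by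
  intro hDM D η hη
  obtain ⟨δ₁, hδ₁, hlast⟩ := ufrs_lastDeparture D η hη
  obtain ⟨δ₂, hδ₂, hcollar⟩ := collarAgreement D η hη
  obtain ⟨δ₃, hδ₃, hdm⟩ := ufrsResidualDoublyMarked_iff.1 hDM D η hη
  refine ⟨min (min δ₁ δ₂) (min δ₃ η), lt_min (lt_min hδ₁ hδ₂) (lt_min hδ₃ hη), ?_⟩
  intro E hEΩ hE hEδ v w ρ hηρ hv hw ω a a' n m k T j i hpair hStr hball hmn hStr₁ hek hsum hcolm hniff hmis hrun hend
    hjT hin hEq hfree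
  have hδ : 0 < E.δ := hE.delta_pos
  have hδ₁' : E.δ < δ₁ := lt_of_lt_of_le hEδ ((min_le_left _ _).trans (min_le_left _ _))
  have hδ₂' : E.δ < δ₂ := lt_of_lt_of_le hEδ ((min_le_left _ _).trans (min_le_right _ _))
  have hδ₃' : E.δ < δ₃ := lt_of_lt_of_le hEδ ((min_le_right _ _).trans (min_le_left _ _))
  have hδη : E.δ ≤ η := (lt_of_lt_of_le hEδ ((min_le_right _ _).trans (min_le_right _ _))).le
  -- the last contact, recomputed from `ufrs_lastDeparture` (it is unique)
  obtain ⟨j₂, i₂, hj₂T, hi₂n, hEq₂, hsimple, hfree₂, -, hlt, -⟩ :=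
    hlast E hEΩ hE hδ₁' v w ρ hηρ hv hw ω a a' n m k T hpair hStr hball hmn.le hStr₁ hek hrun hend
  have hj : j = j₂ := by
    by_contra hne
    rcases Nat.lt_or_gt_of_ne hne with h | h
    · exact hfree j₂ h hj₂T i₂ hi₂n hEq₂
    · exact hfree₂ j h hjT.le i hin hEq
  subst hj
  have hi : i = i₂ := (hsimple _ _ hi₂n hin (hEq₂.symm.trans hEq)).symm
  subst hi
  obtain ⟨hin', -, -, -, -, -, hcol, -⟩ := hlt hjT
  -- faces at deep vertices, along the first stretch, along the run
  have hinner : ∀ x : Site 2, 3 * η ≤ infDist (meshPoint E.δ x) D.carrierᶜ → ∀ f : Site 2,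
      IsCorner x f → E.IsInnerFace f ∧ (shiftData E w).IsInnerFace f := fun x hx =>
    (hcollar E hEΩ hE hδ₂' w hw ω x hx x (by rw [dist_self]; positivity)).2
  have hfaceE : ∀ t ≤ n, E.IsInnerFace (cFace (cornerOrbit (E.bcBondConfig ω) a t)) := by
    intro t ht
    rcases Nat.eq_zero_or_pos t with rfl | hpos
    · rcases hpair with ⟨ha, -⟩ | ⟨-, haI, -⟩
      · exact ha.isOutEdge.1
      · exact (hinner a.1 (deep_of_cSrc_mem_ball hδ.le hδη hηρ hv haI) _ (isCorner_cFace a)).1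
    · obtain ⟨t', rfl⟩ : ∃ t', t = t' + 1 := ⟨t - 1, by omega⟩
      exact (hStr t' (by omega)).2
  have hface₁ : ∀ t, 1 ≤ t → t ≤ T → (shiftData E w).IsInnerFace (cFace (cornerOrbit ((shiftData E w).bcBondConfig ω) (cornerOrbit (E.bcBondConfig ω) a m) t)) := by
    intro t h1 ht
    obtain ⟨t', rfl⟩ : ∃ t', t = t' + 1 := ⟨t - 1, by omega⟩
    exact (hrun t' (by omega)).2
  have hzD : (meshPoint E.δ (cornerOrbit (E.bcBondConfig ω) a i).1) ∈ D.carrier := by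
    rw [← hEΩ]
    exact (ufrs_discrepancyEdges E w ω).2.2 _ (hfaceE i hin)
  have hZ : ω ∈ ufrsCert E w (meshPoint E.δ (cornerOrbit (E.bcBondConfig ω) a i).1) (4 * η) (ρ / 2) → ∃ z ∈ D.carrier, infDist z D.carrierᶜ < 3 * η ∧ ω ∈ ufrsCert E w z (4 * η) (ρ / 2) := fun hc => ⟨_, hzD, hcol, hc⟩
  by_cases hesc : ρ / 2 < 256 * (4 * η)
  · exact hZ (mem_ufrsCert_of_lt_W3H hesc)
  rw [not_lt] at hesc
  -- the outgoing part `O₀ a (i, n]` of the first stretch: a long strand at `z`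
  have hPnear : dist (meshPoint E.δ (cornerOrbit (E.bcBondConfig ω) a (i + 1)).1) (meshPoint E.δ (cornerOrbit (E.bcBondConfig ω) a i).1) ≤ 4 * η := by
    have h1 := dist_meshPoint_cornerOrbit_succ_le (E.bcBondConfig ω) a E.δ i
    rw [abs_of_pos hδ] at h1
    linarith
  have hPfar : ρ / 2 / 2 ≤ dist (meshPoint E.δ (cornerOrbit (E.bcBondConfig ω) a n).1) (meshPoint E.δ (cornerOrbit (E.bcBondConfig ω) a i).1) := by
    have := far_of_near_cTgt_mem_ball_W3H hδ.le hv hcol (z := (meshPoint E.δ (cornerOrbit (E.bcBondConfig ω) a i).1)) (s := 0) (by rw [dist_self]) hball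
      (by rw [dist_self]; exact hδ.le)
    linarith
  have hP : ∀ R' : ℝ, R' ≤ ρ / 2 / 2 → (i + 1) ≤ n ∧ ((dist (meshPoint E.δ (cornerOrbit (E.bcBondConfig ω) a (i + 1)).1) (meshPoint E.δ (cornerOrbit (E.bcBondConfig ω) a i).1) ≤ (4 * η) ∧ R' ≤ dist (meshPoint E.δ (cornerOrbit (E.bcBondConfig ω) a n).1) (meshPoint E.δ (cornerOrbit (E.bcBondConfig ω) a i).1)) ∨ (R' ≤ dist (meshPoint E.δ (cornerOrbit (E.bcBondConfig ω) a (i + 1)).1) (meshPoint E.δ (cornerOrbit (E.bcBondConfig ω) a i).1) ∧ dist (meshPoint E.δ (cornerOrbit (E.bcBondConfig ω) a n).1) (meshPoint E.δ (cornerOrbit (E.bcBondConfig ω) a i).1) ≤ (4 * η))) ∧ (∀ t, (i + 1) ≤ t → t ≤ n → E.IsInnerFace (cFace (cornerOrbit (E.bcBondConfig ω) a t))) ∧ (∀ s t, (i + 1) ≤ s → s < t → t ≤ n → cornerOrbit (E.bcBondConfig ω) a s ≠ cornerOrbit (E.bcBondConfig ω) a t) := fun R' hR' =>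
    ⟨by omega, Or.inl ⟨hPnear, hR'.trans hPfar⟩, fun t _ ht => hfaceE t ht, stretch_ne_of_lt_W3H hsimple le_rfl⟩
  -- the free tail `O₁ e (j, T]` of the run
  have hFnear : dist (meshPoint E.δ (cornerOrbit ((shiftData E w).bcBondConfig ω) (cornerOrbit (E.bcBondConfig ω) a m) (j + 1)).1) (meshPoint E.δ (cornerOrbit (E.bcBondConfig ω) a i).1) ≤ 4 * η := by
    have h1 := dist_meshPoint_cornerOrbit_succ_le ((shiftData E w).bcBondConfig ω) (cornerOrbit (E.bcBondConfig ω) a m) E.δ j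
    rw [abs_of_pos hδ, hEq₂] at h1
    linarith
  have hrunsimple : ∀ i₁ i₂ : ℕ, i₁ ≤ T → i₂ ≤ T → cornerOrbit ((shiftData E w).bcBondConfig ω) (cornerOrbit (E.bcBondConfig ω) a m) i₁ = cornerOrbit ((shiftData E w).bcBondConfig ω) (cornerOrbit (E.bcBondConfig ω) a m) i₂ → i₁ = i₂ :=
    fun i₁ i₂ h1 h2 h => cornerOrbit_injOn_run (I := {x | medialPoint E.δ x ∈ ball (meshPoint E.δ v) ρ})
      (In := (shiftData E w).IsInnerFace) hrun hend h1 h2 h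
  have hF : ∀ R' : ℝ, R' ≤ dist (meshPoint E.δ (cornerOrbit ((shiftData E w).bcBondConfig ω) (cornerOrbit (E.bcBondConfig ω) a m) T).1) (meshPoint E.δ (cornerOrbit (E.bcBondConfig ω) a i).1) → (j + 1) ≤ T ∧ ((dist (meshPoint E.δ (cornerOrbit ((shiftData E w).bcBondConfig ω) (cornerOrbit (E.bcBondConfig ω) a m) (j + 1)).1) (meshPoint E.δ (cornerOrbit (E.bcBondConfig ω) a i).1) ≤ (4 * η) ∧ R' ≤ dist (meshPoint E.δ (cornerOrbit ((shiftData E w).bcBondConfig ω) (cornerOrbit (E.bcBondConfig ω) a m) T).1) (meshPoint E.δ (cornerOrbit (E.bcBondConfig ω) a i).1)) ∨ (R' ≤ dist (meshPoint E.δ (cornerOrbit ((shiftData E w).bcBondConfig ω) (cornerOrbit (E.bcBondConfig ω) a m) (j + 1)).1) (meshPoint E.δ (cornerOrbit (E.bcBondConfig ω) a i).1) ∧ dist (meshPoint E.δ (cornerOrbit ((shiftData E w).bcBondConfig ω) (cornerOrbit (E.bcBondConfig ω) a m) T).1) (meshPoint E.δ (cornerOrbit (E.bcBondConfig ω) a i).1)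 ≤ (4 * η))) ∧ (∀ t, (j + 1) ≤ t → t ≤ T → (shiftData E w).IsInnerFace (cFace (cornerOrbit ((shiftData E w).bcBondConfig ω) (cornerOrbit (E.bcBondConfig ω) a m) t))) ∧ (∀ s t, (j + 1) ≤ s → s < t → t ≤ T → cornerOrbit ((shiftData E w).bcBondConfig ω) (cornerOrbit (E.bcBondConfig ω) a m) s ≠ cornerOrbit ((shiftData E w).bcBondConfig ω) (cornerOrbit (E.bcBondConfig ω) a m) t) := fun R' hR' =>
    ⟨hjT, Or.inl ⟨hFnear, hR'⟩, fun t ht htT => hface₁ t (by omega) htT, stretch_ne_of_lt_W3H hrunsimple le_rfl⟩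
  have hPF : ∀ s t, (i + 1) ≤ s → s ≤ n → (j + 1) ≤ t → t ≤ T → cornerOrbit (E.bcBondConfig ω) a s ≠ cornerOrbit ((shiftData E w).bcBondConfig ω) (cornerOrbit (E.bcBondConfig ω) a m) t :=
    fun s t _ hs ht htT h => hfree₂ t (by omega) htT s hs h.symm
  -- the incoming whisker `O₀ a [0, i)`, read from the contact back to `a`
  have hWnear : 1 ≤ i → dist (meshPoint E.δ (cornerOrbit (E.bcBondConfig ω) a (i - 1)).1) (meshPoint E.δ (cornerOrbit (E.bcBondConfig ω) a i).1) ≤ 4 * η := by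
    intro h1
    have h := dist_meshPoint_cornerOrbit_succ_le (E.bcBondConfig ω) a E.δ (i - 1)
    rw [abs_of_pos hδ, Nat.sub_add_cancel h1, dist_comm] at h
    linarith
  have hW : 1 ≤ i → ∀ R' : ℝ, R' ≤ dist (meshPoint E.δ (cornerOrbit (E.bcBondConfig ω) a 0).1) (meshPoint E.δ (cornerOrbit (E.bcBondConfig ω) a i).1) → 0 ≤ (i - 1) ∧ ((dist (meshPoint E.δ (cornerOrbit (E.bcBondConfig ω) a 0).1) (meshPoint E.δ (cornerOrbit (E.bcBondConfig ω) a i).1) ≤ (4 * η) ∧ R' ≤ dist (meshPoint E.δ (cornerOrbit (E.bcBondConfig ω) a (i - 1)).1) (meshPoint E.δ (cornerOrbit (E.bcBondConfig ω) a i).1)) ∨ (R' ≤ dist (meshPoint E.δ (cornerOrbit (E.bcBondConfig ω) a 0).1) (meshPoint E.δ (cornerOrbit (E.bcBondConfig ω) a i).1) ∧ dist (meshPoint E.δ (cornerOrbit (E.bcBondConfig ω) a (i - 1)).1) (meshPoint E.δ (cornerOrbit (E.bcBondConfig ω) a i).1) ≤ (4 * η))) ∧ (∀ t, 0 ≤ t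 → t ≤ (i - 1) → E.IsInnerFace (cFace (cornerOrbit (E.bcBondConfig ω) a t))) ∧ (∀ s t, 0 ≤ s → s < t → t ≤ (i - 1) → cornerOrbit (E.bcBondConfig ω) a s ≠ cornerOrbit (E.bcBondConfig ω) a t) :=
    fun h1 R' hR' => ⟨Nat.zero_le _, Or.inr ⟨hR', hWnear h1⟩, fun t _ ht => hfaceE t (by omega),
      stretch_ne_of_lt_W3H hsimple (by omega)⟩
  have hWP : ∀ s t, 0 ≤ s → s ≤ (i - 1) → (i + 1) ≤ t → t ≤ n → cornerOrbit (E.bcBondConfig ω) a s ≠ cornerOrbit (E.bcBondConfig ω) a t := by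
    intro s t _ hs _ htn h
    have := hsimple s t (by omega) htn h
    omega
  have hWF : ∀ s t, 0 ≤ s → s ≤ (i - 1) → (j + 1) ≤ t → t ≤ T → cornerOrbit (E.bcBondConfig ω) a s ≠ cornerOrbit ((shiftData E w).bcBondConfig ω) (cornerOrbit (E.bcBondConfig ω) a m) t :=
    fun s t _ hs ht htT h => hfree₂ t (by omega) htT s (by omega) h.symm
  -- case analysis on the end of the run and on the pair
  rcases hend with hballT | hout
  · -- the free tail ends in the ball: a long strand
    have hFfar : ρ / 2 / 2 ≤ dist (meshPoint E.δ (cornerOrbit ((shiftData E w).bcBondConfig ω) (cornerOrbit (E.bcBondConfig ω) a m) T).1) (meshPoint E.δ (cornerOrbit (E.bcBondConfig ω) a i).1) := by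
      have := far_of_near_cTgt_mem_ball_W3H hδ.le hv hcol (z := (meshPoint E.δ (cornerOrbit (E.bcBondConfig ω) a i).1)) (s := 0) (by rw [dist_self]) hballT
        (by rw [dist_self]; exact hδ.le)
      linarith
    rcases hpair with ⟨ha, -⟩ | ⟨rfl, haI, -⟩
    · -- START pair: `a` may be a nearby marked point
      by_cases hDW : ρ / 2 / 2 ≤ dist (meshPoint E.δ a.1) (meshPoint E.δ (cornerOrbit (E.bcBondConfig ω) a i).1)
      · have h1 : 1 ≤ i := by
          rcases Nat.eq_zero_or_pos i with rfl | h
          · exfalso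
            change ρ / 2 / 2 ≤ dist (meshPoint E.δ a.1) (meshPoint E.δ a.1) at hDW
            rw [dist_self] at hDW
            linarith
          · exact h
        exact hZ (mem_ufrsCert_of_three_far_W3H true true false a a (cornerOrbit (E.bcBondConfig ω) a m) 0 (i - 1) (i + 1) n (j + 1) T hη hesc
          (hW h1 _ hDW) (hP _ le_rfl) (hF _ hFfar) hWP hWF hPF)
      · rw [not_le] at hDW
        have hmk : ∃ e₀ : Sym2 (Site 2), (e₀ ∈ E.zdABEdges ∨ e₀ ∈ (shiftData E w).zdABEdges) ∧
            dist (medialPoint E.δ e₀) (meshPoint E.δ (cornerOrbit (E.bcBondConfig ω) a i).1) ≤ dist (meshPoint E.δ a.1) (meshPoint E.δ (cornerOrbit (E.bcBondConfig ω) a i).1) + E.δ := by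
          refine ⟨cSrc a, Or.inl (DiscreteDobrushin.cSrc_mem_zdABEdges ha.mem_zdArcA ha.mem_zdArcB (Or.inl ha.isOutEdge)), ?_⟩
          have h1 := dist_medialPoint_cSrc_le' hδ.le a
          have h2 := dist_triangle (medialPoint E.δ (cSrc a)) (meshPoint E.δ a.1) (meshPoint E.δ (cornerOrbit (E.bcBondConfig ω) a i).1)
          linarith
        refine hZ (mem_ufrsCert_of_two_far_and_marked_W3H true false true a (cornerOrbit (E.bcBondConfig ω) a m) a (i + 1) n (j + 1) T 0 (i - 1) hη hδη hDW hmk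
          hP (fun R' hR' => hF R' (hR'.trans hFfar)) hPF (fun hbig => ?_))
        have h1 : 1 ≤ i := by
          rcases Nat.eq_zero_or_pos i with rfl | h
          · exfalso
            change 64 * (4 * η) < dist (meshPoint E.δ a.1) (meshPoint E.δ a.1) + E.δ at hbig
            rw [dist_self] at hbig
            linarith
          · exact h
        exact ⟨hW h1 _ le_rfl, fun s t hs hsn ht hti h => hWP t s ht hti hs hsn h.symm,
          fun s t hs hsT ht hti h => hWF t s ht hti hs hsT h.symm⟩
    · -- an exit corner of the ball: the whisker is long
      have h1 : 1 ≤ i := by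
        rcases Nat.eq_zero_or_pos i with rfl | h
        · exfalso
          have hdeep := deep_of_cSrc_mem_ball (Ω := D.carrier) hδ.le hδη hηρ hv haI
          change infDist (meshPoint E.δ a.1) D.carrierᶜ < 3 * η at hcol
          linarith
        · exact h
      have hWfar : ρ / 2 / 2 ≤ dist (meshPoint E.δ (cornerOrbit (E.bcBondConfig ω) a 0).1) (meshPoint E.δ (cornerOrbit (E.bcBondConfig ω) a i).1) := by
        have := far_of_cSrc_mem_ball (E := E) hδ.le hv hcol haI
        change ρ / 2 / 2 ≤ dist (meshPoint E.δ a.1) _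
        linarith
      exact hZ (mem_ufrsCert_of_three_far_W3H true true false a a (cornerOrbit (E.bcBondConfig ω) a m) 0 (i - 1) (i + 1) n (j + 1) T hη hesc
        (hW h1 _ hWfar) (hP _ le_rfl) (hF _ hFfar) hWP hWF hPF)
  · -- the free tail ends at the exit corner of the translate: a marked edge
    have hE₁ : (shiftData E w).IsZdAdmissible := isZdAdmissible_shiftData E w hE
    have hinT : (shiftData E w).IsInnerFace (cFace (cornerOrbit ((shiftData E w).bcBondConfig ω) a' (k + T))) := by
      rw [cornerOrbit_add_eq, hek]
      exact hface₁ T (by omega) le_rfl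
    have houtT : ¬ (shiftData E w).IsInnerFace (cFace (cornerOrbit ((shiftData E w).bcBondConfig ω) a' (k + T + 1))) := by
      rw [show k + T + 1 = k + (T + 1) by ring, cornerOrbit_add_eq, hek]
      exact hout
    have hgood : a'.1 ∉ (shiftData E w).zdArcB ∨ ∀ f, IsCorner a'.1 f → (shiftData E w).IsInnerFace f := by
      rcases hpair with ⟨-, ha'⟩ | ⟨h, haI, -⟩
      · exact Or.inl (fun hB => Set.disjoint_left.1 hE₁.disjoint ha'.mem_zdArcA hB)
      · rw [← h]
        exact Or.inr (fun f hf => (hinner a.1 (deep_of_cSrc_mem_ball hδ.le hδη hηρ hv haI) f hf).2)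
    obtain ⟨-, hqA, hqB, hqIn, hqAB⟩ := runEnd_exitType_W3H hE ω w hinT houtT hgood
    have hkT : cornerOrbit ((shiftData E w).bcBondConfig ω) a' (k + T) = cornerOrbit ((shiftData E w).bcBondConfig ω) (cornerOrbit (E.bcBondConfig ω) a m) T := by
      rw [cornerOrbit_add_eq, hek]
    rw [hkT] at hqA hqB hqIn hqAB
    have hmkF : ∃ e₀ : Sym2 (Site 2), (e₀ ∈ E.zdABEdges ∨ e₀ ∈ (shiftData E w).zdABEdges) ∧
        dist (medialPoint E.δ e₀) (meshPoint E.δ (cornerOrbit (E.bcBondConfig ω) a i).1) ≤ dist (meshPoint E.δ (cornerOrbit ((shiftData E w).bcBondConfig ω) (cornerOrbit (E.bcBondConfig ω) a m) T).1) (meshPoint E.δ (cornerOrbit (E.bcBondConfig ω) a i).1) + E.δ := by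
      refine ⟨cTgt (cornerOrbit ((shiftData E w).bcBondConfig ω) (cornerOrbit (E.bcBondConfig ω) a m) T), Or.inr hqAB, ?_⟩
      have h1 := dist_medialPoint_cTgt_le' hδ.le (cornerOrbit ((shiftData E w).bcBondConfig ω) (cornerOrbit (E.bcBondConfig ω) a m) T)
      have h2 := dist_triangle (medialPoint E.δ (cTgt (cornerOrbit ((shiftData E w).bcBondConfig ω) (cornerOrbit (E.bcBondConfig ω) a m) T))) (meshPoint E.δ (cornerOrbit ((shiftData E w).bcBondConfig ω) (cornerOrbit (E.bcBondConfig ω) a m) T).1) (meshPoint E.δ (cornerOrbit (E.bcBondConfig ω) a i).1)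
      linarith
    rcases hpair with ⟨ha, ha'⟩ | ⟨rfl, haI, -⟩
    · -- START pair
      by_cases hDF : ρ / 2 / 2 ≤ dist (meshPoint E.δ (cornerOrbit ((shiftData E w).bcBondConfig ω) (cornerOrbit (E.bcBondConfig ω) a m) T).1) (meshPoint E.δ (cornerOrbit (E.bcBondConfig ω) a i).1)
      · have hFfar := hDF
        by_cases hDW : ρ / 2 / 2 ≤ dist (meshPoint E.δ a.1) (meshPoint E.δ (cornerOrbit (E.bcBondConfig ω) a i).1)
        · have h1 : 1 ≤ i := by
            rcases Nat.eq_zero_or_pos i with rfl | h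
            · exfalso
              change ρ / 2 / 2 ≤ dist (meshPoint E.δ a.1) (meshPoint E.δ a.1) at hDW
              rw [dist_self] at hDW
              linarith
            · exact h
          exact hZ (mem_ufrsCert_of_three_far_W3H true true false a a (cornerOrbit (E.bcBondConfig ω) a m) 0 (i - 1) (i + 1) n (j + 1) T hη hesc
            (hW h1 _ hDW) (hP _ le_rfl) (hF _ hFfar) hWP hWF hPF)
        · rw [not_le] at hDW
          have hmk : ∃ e₀ : Sym2 (Site 2), (e₀ ∈ E.zdABEdges ∨ e₀ ∈ (shiftData E w).zdABEdges) ∧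
              dist (medialPoint E.δ e₀) (meshPoint E.δ (cornerOrbit (E.bcBondConfig ω) a i).1) ≤ dist (meshPoint E.δ a.1) (meshPoint E.δ (cornerOrbit (E.bcBondConfig ω) a i).1) + E.δ := by
            refine ⟨cSrc a, Or.inl (DiscreteDobrushin.cSrc_mem_zdABEdges ha.mem_zdArcA ha.mem_zdArcB (Or.inl ha.isOutEdge)), ?_⟩
            have h1 := dist_medialPoint_cSrc_le' hδ.le a
            have h2 := dist_triangle (medialPoint E.δ (cSrc a)) (meshPoint E.δ a.1) (meshPoint E.δ (cornerOrbit (E.bcBondConfig ω) a i).1)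
            linarith
          refine hZ (mem_ufrsCert_of_two_far_and_marked_W3H true false true a (cornerOrbit (E.bcBondConfig ω) a m) a (i + 1) n (j + 1) T 0 (i - 1) hη hδη hDW hmk
            hP (fun R' hR' => hF R' (hR'.trans hFfar)) hPF (fun hbig => ?_))
          have h1 : 1 ≤ i := by
            rcases Nat.eq_zero_or_pos i with rfl | h
            · exfalso
              change 64 * (4 * η) < dist (meshPoint E.δ a.1) (meshPoint E.δ a.1) + E.δ at hbig
              rw [dist_self] at hbig
              linarith
            · exact h
          exact ⟨hW h1 _ le_rfl, fun s t hs hsn ht hti h => hWP t s ht hti hs hsn h.symm,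
            fun s t hs hsT ht hti h => hWF t s ht hti hs hsT h.symm⟩
      · rw [not_le] at hDF
        by_cases hDW : ρ / 2 / 2 ≤ dist (meshPoint E.δ a.1) (meshPoint E.δ (cornerOrbit (E.bcBondConfig ω) a i).1)
        · have h1 : 1 ≤ i := by
            rcases Nat.eq_zero_or_pos i with rfl | h
            · exfalso
              change ρ / 2 / 2 ≤ dist (meshPoint E.δ a.1) (meshPoint E.δ a.1) at hDW
              rw [dist_self] at hDW
              linarith
            · exact h
          exact hZ (mem_ufrsCert_of_two_far_and_marked_W3H true true false a a (cornerOrbit (E.bcBondConfig ω) a m) 0 (i - 1) (i + 1) n (j + 1) T hη hδη hDF hmkF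
            (fun R' hR' => hW h1 R' (hR'.trans hDW)) hP hWP (fun _ => ⟨hF _ le_rfl, hWF, hPF⟩))
        · rw [not_le] at hDW
          -- the doubly marked configuration: the registered residual sub-goal
          exact hdm E hEΩ hE hδ₃' v w ρ hηρ hv hw ω a a' n m k T j i (Or.inl ⟨ha, ha'⟩) hStr hball hmn hStr₁ hek hsum
            hcolm hniff hmis hrun (Or.inr hout) hjT hin hEq hfree ha ha' hout hDF hDW
    · -- an exit corner of the ball: the whisker is long
      have h1 : 1 ≤ i := by
        rcases Nat.eq_zero_or_pos i with rfl | h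
        · exfalso
          have hdeep := deep_of_cSrc_mem_ball (Ω := D.carrier) hδ.le hδη hηρ hv haI
          change infDist (meshPoint E.δ a.1) D.carrierᶜ < 3 * η at hcol
          linarith
        · exact h
      have hWfar : ρ / 2 / 2 ≤ dist (meshPoint E.δ (cornerOrbit (E.bcBondConfig ω) a 0).1) (meshPoint E.δ (cornerOrbit (E.bcBondConfig ω) a i).1) := by
        have := far_of_cSrc_mem_ball (E := E) hδ.le hv hcol haI
        change ρ / 2 / 2 ≤ dist (meshPoint E.δ a.1) _
        linarith
      by_cases hDF : ρ / 2 / 2 ≤ dist (meshPoint E.δ (cornerOrbit ((shiftData E w).bcBondConfig ω) (cornerOrbit (E.bcBondConfig ω) a m) T).1) (meshPoint E.δ (cornerOrbit (E.bcBondConfig ω) a i).1)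
      · exact hZ (mem_ufrsCert_of_three_far_W3H true true false a a (cornerOrbit (E.bcBondConfig ω) a m) 0 (i - 1) (i + 1) n (j + 1) T hη hesc
          (hW h1 _ hWfar) (hP _ le_rfl) (hF _ hDF) hWP hWF hPF)
      · rw [not_le] at hDF
        exact hZ (mem_ufrsCert_of_two_far_and_marked_W3H true true false a a (cornerOrbit (E.bcBondConfig ω) a m) 0 (i - 1) (i + 1) n (j + 1) T hη hδη hDF hmkF
          (fun R' hR' => hW h1 R' (hR'.trans hWfar)) hP hWP (fun _ => ⟨hF _ le_rfl, hWF, hPF⟩))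

end

end Summit.CriticalPhenomena.CardyFormulaZ2.Cruxes.EdgePrecompact.QkzStripBoundaryArm
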